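import Summits.HodgeConjecture.HodgeConjecture.Theses.SaitoKurokawaBridge
import Literature.AlgebraicGeometry.HodgeTheory.ComplexOrientationFamily
import Literature.AlgebraicGeometry.Motives.JacobianFiniteIndex
import Literature.AlgebraicTopology.SingularHomology.ExcisionMayerVietorisProofs

/-!
# Stub 1 of the birth skeleton of `SaitoKurokawaCoverPeriodsVanish` (item 18127), PROVED:
# the Gysin transfer of the period to `M.Z`

* `complexGysin_injective_top` — for ANY morphism `p : W ⟶ Y` of smooth projective varieties the Gysin
  morphism is injective on the top degree `H^{2 dim W}(W(ℂ))` (`p_* y ⌢ [Y] = p(ℂ)_*(y ⌢ [W])` in `H₀`,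
  `capProduct_complexGysin`; `p(ℂ)_*` is injective on `H₀` of the path-connected `W(ℂ)`,
  `singularHomology.mono_map_zero_of_pathConnectedSpace`; and `y ↦ y ⌢ [W]` is bijective, Poincaré
  duality for the complex orientation family).
* `stub_gysinTransfer_proof` — hence `a ∪ p_* q^* b = 0` on `M.Z` implies `p^*a ∪ q^*b = 0` on `W`
  (projection formula `complexGysin_cup`: `p_*(p^*a ∪ q^*b) = a ∪ p_*(q^*b)`), with NO dominance
  hypothesis needed. This discharges `stub_gysinTransfer` of `BirthSaitoKurokawaCoverPeriodsVanish.lean`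
  and reduces item 18127 to its transfer form `stub_transportedClassOrthogonal` exactly.
-/

set_option linter.dupNamespace false

open CategoryTheory MonoidalCategory AlgebraicGeometry
open Literature.AlgebraicGeometry Literature.AlgebraicGeometry.HodgeTheory
open Literature.AlgebraicTopology.SingularHomology

namespace Summit.HodgeConjecture.HodgeConjecture.Cruxes.ExtremeBridgeFailure.CoverPeriods

open Summit.HodgeConjecture.HodgeConjecture.Theses.SaitoKurokawaBridge

/-- The Gysin morphism `p_* : H¹⁷(W(ℂ)) → H¹⁷(M.Z(ℂ))` of a morphism of smooth projective `17`-folds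
(complex orientation family) — as in the birth skeleton. -/
noncomputable abbrev transport {W Y : Motives.SchemeOver ℂ} (hW : Motives.IsSmoothProjective 17 W)
    (hY : Motives.IsSmoothProjective 17 Y) (p : W ⟶ Y) :
    complexBetti W 17 →ₗ[ℂ] complexBetti Y 17 :=
  complexGysin complexOrientationFamily hW hY p (rfl : 17 + 2 * 17 = 17 + 2 * 17)

/-- **Gysin morphisms are injective on the top degree of the source**, for every morphism of smooth
projective complex varieties: `p_* y = 0` gives `p(ℂ)_*(y ⌢ [W(ℂ)]) = p_* y ⌢ [Y(ℂ)] = 0` in `H₀`,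
`p(ℂ)_*` is injective on `H₀` (`W(ℂ)` is path connected) and `y ↦ y ⌢ [W(ℂ)]` is injective
(Poincaré duality). -/
theorem complexGysin_injective_top {m n a b : ℕ} {W Y : Motives.SchemeOver ℂ}
    (hW : Motives.IsSmoothProjective m W) (hY : Motives.IsSmoothProjective n Y) (p : W ⟶ Y)
    (hab : a + 2 * n = b + 2 * m) (ha : a + 0 = 2 * m) (hb : b + 0 = 2 * n) :
    Function.Injective (complexGysin complexOrientationFamily hW hY p hab) := by
  have hPD := hasPoincareDuality_complexOrientationFamily
  rw [injective_iff_map_eq_zero]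
  intro y hy
  have hcap := capProduct_complexGysin hPD hW hY p hab ha hb y
  rw [hy, LinearMap.map_zero₂] at hcap
  haveI := hW.pathConnectedSpace
  have hinj : Function.Injective
      (singularHomology.map ℂ ℂ (Motives.AlgPoints.mapContinuous (L := ℂ) p) 0) := by
    rw [← ModuleCat.mono_iff_injective]
    exact singularHomology.mono_map_zero_of_pathConnectedSpace ℂ ℂ _
  have h0 : capProduct ha y (complexOrientationFamily hW).fundamentalClass = 0 :=
    hinj (by rw [map_zero]; exact hcap.symm)
  have hbij := hPD hW ha
  refine hbij.1 ?_
  rw [poincareDualityMap_apply, poincareDualityMap_apply, h0, LinearMap.map_zero₂]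

/-- **Stub 1 of the birth skeleton, proved**: if the transported class `p_* q^* b` is orthogonal to
`a` on `M.Z`, the period `p^*a ∪ q^*b` vanishes on `W` (projection formula + top-degree injectivity of
`p_*`; the dominance hypothesis of the stub is not even needed). -/
theorem stub_gysinTransfer_proof :
    ∀ (M : Literature.AlgebraicGeometry.ModuliOfCurves.StableCurvesModuliCover ℂ 1 17)
      (N : Literature.AlgebraicGeometry.ModuliOfCurves.StableCurvesModuliCover ℂ 2 14)
      (a : complexBetti M.Z 17) (b : complexBetti N.Z 17)
      (W : Motives.SchemeOver ℂ) (hW : Motives.IsSmoothProjective 17 W) (p : W ⟶ M.Z) (q : W ⟶ N.Z),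
      closure (Set.range p.left.base) = Set.univ →
      cupProduct (rfl : 17 + 17 = 17 + 17) a
          (transport hW (M.isSmoothProjective : Motives.IsSmoothProjective 17 M.Z) p
            (complexBetti.map q 17 b)) = 0 →
      cupProduct (rfl : 17 + 17 = 17 + 17) (complexBetti.map p 17 a) (complexBetti.map q 17 b) = 0 := by
  intro M N a b W hW p q _ h0
  have hM : Motives.IsSmoothProjective 17 M.Z := M.isSmoothProjective
  have hPD := hasPoincareDuality_complexOrientationFamily
  have hinj := complexGysin_injective_top hW hM p
    (show (17 + 17) + 2 * 17 = (17 + 17) + 2 * 17 from rfl) rfl rfl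
  apply hinj
  rw [map_zero, complexGysin_cup hPD hW hM p (hpq := (rfl : 17 + 17 = 17 + 17))
    (hab := (show (17 + 17) + 2 * 17 = (17 + 17) + 2 * 17 from rfl))
    (hq := (rfl : 17 + 2 * 17 = 17 + 2 * 17)) (hpq' := (rfl : 17 + 17 = 17 + 17))]
  exact h0

end Summit.HodgeConjecture.HodgeConjecture.Cruxes.ExtremeBridgeFailure.CoverPeriods
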